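import Summits.QuantumFields.YangMills.Theorems.BalabanLadderIRLightCodeDefs
import HarnessLib

/-!
# Route `BalabanLadder`, crux `IR` (stmt-QuantumFields-19354): flux-code blindness — abstract blindness, necessity, W-currency

Companion lemmas of the crux-idea card `Cruxes/IR/Ideas/ym19354-5-flux-code-blindness.md` (seat `ym-cruxidea-19354-5`
gen 3; `Sketch-g3.lean` rev 3 sha16 `c463f541daed4b01`, evidence #48 on stmt-QuantumFields-19354), landed per route-owner
ruling R34 (ym-beyond-p2 g25) `--supports stmt-QuantumFields-19354` (helper).  Route-independent (imports the Defs module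
only).  None of these is on the composition path of `IR_of_lightCodePincer` (`BalabanLadderIRLightCodePincer`); they record
(i) the first Lean steps of the two ENGINES the certificate needs, (ii) that the landed `q = 0` vacuum format is the rank-zero
light code, (iii) the algebraic core of the NECESSITY argument (reflection positivity inside flux sectors ⇒ sector-mean
blindness is forced by `GapInUnits`), (iv) the order-free lattice W-currency's relation to the landed cold-pressure clause.

* §1 `inner_small_of_localised` — OFF-DIAGONAL blindness from localisation: states `τ`-localised in events `Q`, `Q'` with
  `Q† A Q' = 0` have `|⟨ψ, A ψ'⟩| ≤ ‖A‖(2τ + τ²)`; `orth_of_commute` — its orthogonality hypothesis for a multiplication-like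
  `A` (commutes with the symmetric event projection, disjoint events).
* §2 `lightCodeModel_rank_zero` (`q = 0`: the landed vacuum format IS a light code with `εc = 0`), `secExcess_rank_zero`.
* §3 necessity core (law of total covariance with reflection-positive sectors): `weight_mul_sq_sub_mean_le_totalCov`,
  `abs_sectorMean_sub_mean_le` (a sector of weight `≥ wmin` has its mean within `√(ε/wmin)` of the torus mean when the total
  reflected covariance is `≤ ε`).
* §4 W-currency: `lightMultipletPressureAt_zero_iff` (`Q = 0` ⟺ VERBATIM the cold-pressure clause (ii) of the landed
  `abs_latticeConnectedCorr_le_of_coldPressure`), `LightMultipletPressureAt.mono` (monotone in the rank).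

[folklore] linear algebra ∕ elementary probability; 't Hooft, Nucl. Phys. B153 (1979) and Greensite (2011) (4.47) for the
physics of the light flux multiplet (informal context only).  Nothing here is summit-bearing; not a gap claim.
-/

set_option autoImplicit false

noncomputable section

open scoped BigOperators InnerProductSpace
open InnerProductSpace
open Literature.MathematicalPhysics.QuantumFieldTheory Literature.MathematicalPhysics.QuantumLattice

namespace Summit.QuantumFields.YangMills.Cruxes.IR.FluxCodeBlindness

/-! ## §1 Off-diagonal blindness from localisation -/

section Abstract

variable {E : Type*} [NormedAddCommGroup E] [InnerProductSpace ℝ E]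

/-- **Off-diagonal blindness from localisation (PROVED).**  If `ψ` is `τ`-close to `Q ψ`, `ψ'` is `τ`-close to `Q' ψ'`,
both of norm `≤ 1`, and `A` has no matrix elements between the ranges (`⟨Q u, A (Q' v)⟩ = 0`), then
`|⟨ψ, A ψ'⟩| ≤ ‖A‖ (2τ + τ²)`.  (Flux vacua localised in DISJOINT coarse-flux events, `A` a local multiplication operator.)
[folklore] -/
theorem inner_small_of_localised (A Q Q' : E →L[ℝ] E) (ψ ψ' : E) (τ : ℝ) (hτ : 0 ≤ τ)
    (hψ : ‖ψ‖ ≤ 1) (hψ' : ‖ψ'‖ ≤ 1) (h1 : ‖ψ - Q ψ‖ ≤ τ) (h2 : ‖ψ' - Q' ψ'‖ ≤ τ)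
    (horth : ∀ u v : E, inner ℝ (Q u) (A (Q' v)) = 0) :
    |inner ℝ ψ (A ψ')| ≤ ‖A‖ * (2 * τ + τ ^ 2) := by
  have hA : 0 ≤ ‖A‖ := norm_nonneg _
  -- decomposition `⟨ψ, A ψ'⟩ = ⟨ψ − Qψ, A ψ'⟩ + ⟨Qψ, A (ψ' − Q'ψ')⟩ + ⟨Qψ, A (Q'ψ')⟩`
  have hsplit : inner ℝ ψ (A ψ') =
      inner ℝ (ψ - Q ψ) (A ψ') + inner ℝ (Q ψ) (A (ψ' - Q' ψ')) + inner ℝ (Q ψ) (A (Q' ψ')) := by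
    simp only [map_sub, inner_sub_left, inner_sub_right]
    ring
  rw [hsplit, horth, add_zero]
  have hQψ : ‖Q ψ‖ ≤ 1 + τ := by
    have : Q ψ = ψ - (ψ - Q ψ) := by abel
    rw [this]
    exact (norm_sub_le _ _).trans (add_le_add hψ h1)
  have t1 : |inner ℝ (ψ - Q ψ) (A ψ')| ≤ τ * ‖A‖ := by
    refine (abs_real_inner_le_norm _ _).trans ?_
    have hAψ' : ‖A ψ'‖ ≤ ‖A‖ := (A.le_opNorm ψ').trans (by nlinarith [norm_nonneg ψ'])
    exact mul_le_mul h1 hAψ' (norm_nonneg _) hτ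
  have t2 : |inner ℝ (Q ψ) (A (ψ' - Q' ψ'))| ≤ (1 + τ) * (‖A‖ * τ) := by
    refine (abs_real_inner_le_norm _ _).trans ?_
    have hAd : ‖A (ψ' - Q' ψ')‖ ≤ ‖A‖ * τ := (A.le_opNorm _).trans (mul_le_mul_of_nonneg_left h2 hA)
    exact mul_le_mul hQψ hAd (norm_nonneg _) (by linarith)
  calc |inner ℝ (ψ - Q ψ) (A ψ') + inner ℝ (Q ψ) (A (ψ' - Q' ψ'))|
      ≤ |inner ℝ (ψ - Q ψ) (A ψ')| + |inner ℝ (Q ψ) (A (ψ' - Q' ψ'))| := abs_add_le _ _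
    _ ≤ τ * ‖A‖ + (1 + τ) * (‖A‖ * τ) := add_le_add t1 t2
    _ = ‖A‖ * (2 * τ + τ ^ 2) := by ring

/-- The orthogonality hypothesis of `inner_small_of_localised` for a MULTIPLICATION-like operator: `A` commutes with the
symmetric event projection `Q`, and the events are disjoint (`Q Q' = 0`). [folklore] -/
theorem orth_of_commute (A Q Q' : E →L[ℝ] E) (hQsymm : ∀ u v : E, inner ℝ (Q u) v = inner ℝ u (Q v))
    (hcomm : ∀ v, Q (A v) = A (Q v)) (hdisj : ∀ v, Q (Q' v) = 0) :
    ∀ u v : E, inner ℝ (Q u) (A (Q' v)) = 0 := by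
  intro u v
  rw [hQsymm, hcomm, hdisj, map_zero, inner_zero_right]

end Abstract

/-! ## §2 The landed vacuum format is the rank-zero light code -/

/-- **`q = 0`: the landed vacuum format is a light code with `εc = 0`** — the cold-pressure models of
`abs_latticeConnectedCorr_le_of_coldPressure` (vacuum `Ω`, `T Ω = Ω`, contraction `ρ` on `Ω^⊥`) are the rank-zero case. -/
theorem lightCodeModel_rank_zero {d : ℕ} (T Ao Bo : Euc d →L[ℝ] Euc d) (Ω : Euc d) (ρ : ℝ) (w : ℕ)
    (hT : T.IsPositive) (hΩ : ‖Ω‖ = 1) (hTΩ : T Ω = Ω) (hcon : ∀ v, inner ℝ Ω v = 0 → ‖T v‖ ≤ ρ * ‖v‖) :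
    LightCodeModel T Ao Bo (fun _ : Fin 1 => Ω) (fun _ => 1) ρ 0 w := by
  refine ⟨hT, ?_, fun k => by simp [hTΩ], rfl, fun k => ⟨zero_le_one, le_rfl⟩, ?_, ?_, ?_⟩
  · rw [orthonormal_iff_ite]
    intro i j
    have hij : i = j := Fin.ext (by have h1 := i.isLt; have h2 := j.isLt; omega)
    simp only [hij, if_true, real_inner_self_eq_norm_sq, hΩ, one_pow]
  · intro v hv
    exact hcon v (hv 0)
  · intro k l
    have hkl : k = l := Fin.ext (by have h1 := k.isLt; have h2 := l.isLt; omega)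
    simp [hkl]
  · intro k l
    have hkl : k = l := Fin.ext (by have h1 := k.isLt; have h2 := l.isLt; omega)
    simp [hkl]

/-- For `q = 0` the sector excess is the landed `tr T^m − 1`. -/
theorem secExcess_rank_zero {d : ℕ} (T : Euc d →L[ℝ] Euc d) (m : ℕ) :
    secExcess T (fun _ : Fin 1 => (1 : ℝ)) m = tr' (T ^ m) - 1 := by
  simp [secExcess]


/-! ## §3  Necessity core (RP INSIDE flux sectors): the law of total covariance

Informal setting (card «Why it bites here — NECESSITY»).  Let `k` range over the coarse flux sectors of the periodic torus
(`η ∈ H²(T³; π₁ G)`), `w k` the sector weights of the torus state `μ` (`Σ w = 1`), `μ_k = μ(·| sector k)`.  For a reflection-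
invariant sector (every sector when `π₁ G` has exponent 2, e.g. `SO(3)`; symmetrised pairs `{η, −η}` otherwise) the conditioned
state `μ_k` is REFLECTION POSITIVE (the coarse flux indicator is measurable on the reflection slice(s) and `Θ`-invariant, so
`⟨Θf · f · Q⟩ = ⟨Θ(fQ) · (fQ)⟩ ≥ 0`; site- or link-hyperplane RP of the Wilson action, tree `TorusOddRP` ∕ `WilsonOddRPKernel`;
NOT the diagonal mirrors of `not_diagonalReflectionPositive`) and `Θ`-invariant, hence with `a k := ⟨A⟩_{μ_k} = ⟨ΘA⟩_{μ_k}` and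
`m k := ⟨ΘA · A⟩_{μ_k}` one has `a k ^ 2 ≤ m k` (hypothesis `hrp`).  The total reflected covariance
`Cov_μ(ΘA, A) = Σ w m − (Σ w a)²` is what `GapInUnits` bounds by `C_A e^{−c₁ a n}` (`n ≤ S`, `A` placed at time distance `n/2` from
the reflection plane).  The two theorems below are the algebraic core: EVERY sector mean is then `√(C_A e^{−c₁ a n} / w_k)`-close to
the torus mean — with the light sectors equipopulated (`w_k ≈ |π₁ G|^{−3}`, the `LightFluxMode` input) this is sector-MEAN BLINDNESS
of every local species at half the `GapInUnits` rate: the diagonal half of the code condition is a CONSEQUENCE of `IR`.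
Not typed here (no flux-sector infrastructure in the tree): the coarse sectors (engine (E)), `Θ`-invariance∕RP of `μ_k`, lightness. -/

section Necessity

/-- Law of total covariance with reflection-positive sectors: the between-sector variance of the sector means is dominated by
the total reflected covariance, termwise.  `w` = sector weights, `a` = sector means of `A` (= of `ΘA`), `m` = sector second
moments `⟨ΘA·A⟩_k`; `hrp` = reflection positivity inside each sector. -/
theorem weight_mul_sq_sub_mean_le_totalCov {K : ℕ} (w a m : Fin K → ℝ) (η : Fin K)
    (hw : ∀ k, 0 ≤ w k) (hw1 : ∑ k, w k = 1) (hrp : ∀ k, a k ^ 2 ≤ m k) :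
    w η * (a η - ∑ k, w k * a k) ^ 2 ≤ (∑ k, w k * m k) - (∑ k, w k * a k) ^ 2 := by
  set abar : ℝ := ∑ k, w k * a k with habar
  -- between-sector variance = Σ w a² − ā²
  have h1 : ∑ k, w k * (a k - abar) ^ 2 = (∑ k, w k * a k ^ 2) - abar ^ 2 := by
    have e : ∀ k, w k * (a k - abar) ^ 2 = w k * a k ^ 2 - 2 * abar * (w k * a k) + abar ^ 2 * w k :=
      fun k => by ring
    simp_rw [e, Finset.sum_add_distrib, Finset.sum_sub_distrib, ← Finset.mul_sum, hw1, ← habar]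
    ring
  have h2 : w η * (a η - abar) ^ 2 ≤ ∑ k, w k * (a k - abar) ^ 2 :=
    Finset.single_le_sum (f := fun k => w k * (a k - abar) ^ 2)
      (fun k _ => mul_nonneg (hw k) (sq_nonneg _)) (Finset.mem_univ η)
  have h3 : ∑ k, w k * a k ^ 2 ≤ ∑ k, w k * m k :=
    Finset.sum_le_sum fun k _ => mul_le_mul_of_nonneg_left (hrp k) (hw k)
  calc w η * (a η - abar) ^ 2 ≤ ∑ k, w k * (a k - abar) ^ 2 := h2
    _ = (∑ k, w k * a k ^ 2) - abar ^ 2 := h1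
    _ ≤ (∑ k, w k * m k) - abar ^ 2 := by linarith

/-- Sector-mean blindness is NECESSARY: if the total reflected covariance is `≤ ε` (what `GapInUnits` gives, `ε = C_A e^{−c₁ a n}`)
and sector `η` carries weight `≥ wmin > 0` (lightness ∕ equipopulation of the flux vacua), then its mean of `A` is within
`√(ε / wmin)` of the torus mean. -/
theorem abs_sectorMean_sub_mean_le {K : ℕ} (w a m : Fin K → ℝ) (η : Fin K) (ε wmin : ℝ)
    (hw : ∀ k, 0 ≤ w k) (hw1 : ∑ k, w k = 1) (hrp : ∀ k, a k ^ 2 ≤ m k)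
    (hcov : (∑ k, w k * m k) - (∑ k, w k * a k) ^ 2 ≤ ε) (hwmin : 0 < wmin) (hη : wmin ≤ w η) :
    |a η - ∑ k, w k * a k| ≤ Real.sqrt (ε / wmin) := by
  have h := weight_mul_sq_sub_mean_le_totalCov w a m η hw hw1 hrp
  have hsq : 0 ≤ (a η - ∑ k, w k * a k) ^ 2 := sq_nonneg _
  have h' : wmin * (a η - ∑ k, w k * a k) ^ 2 ≤ ε :=
    le_trans (le_trans (mul_le_mul_of_nonneg_right hη hsq) h) hcov
  apply Real.abs_le_sqrt
  rw [le_div_iff₀ hwmin]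
  linarith [h']

end Necessity

/-! ## §4  The lattice-level (W)-currency: cold pressure MODULO A LIGHT MULTIPLET (order-free, partition functions only)

't Hooft's picture of the cold periodic torus at `π₁(G) ≠ 1`, in the currency of the LANDED `traceExcess`
(`Literature/…/WilsonTransferKernel`): the normalised partition function of the cold torus `m × (2S+1)³` is a sum of AT MOST
`Q+1` pure exponentials up to the thermal error,
`Z_β(m × (2S+1)³)/λ₊^m = 1 + Σ_{k<Q} θ_k^m + O(C₀ (2S+1)³ e^{−μ m})`, `θ_k ∈ [0,1]` the (volume-dependent) light flux levels.
`Q = 0` is VERBATIM hypothesis (ii) of the landed `abs_latticeConnectedCorr_le_of_coldPressure` (gen 2's `ColdPressureAt`), which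
`LightFluxMode SO(3)` makes unsatisfiable at weak coupling (gen 2 §5); `Q ≥ |π₁ G|³ − 1` absorbs the light flux multiplet.  This is
the statement engine (W) must produce at weak coupling (where `IsCompactSimpleLieGroup` is spent: no finite `Q` works with a photon).
No operator, no eigenvalue ordering: only `cyclicPartition` ∕ `transferSpectralRadius` through `traceExcess`. -/

section LatticeW

variable {G : Type} [Group G] [TopologicalSpace G] [IsTopologicalGroup G] [CompactSpace G]
  [MeasurableSpace G] [BorelSpace G]

/-- `Q = 0` is exactly the cold-pressure clause (ii) of the landed `abs_latticeConnectedCorr_le_of_coldPressure`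
(gen 2's `ColdPressureAt r β μ`, with `C₀, L` species-uniform). -/
theorem lightMultipletPressureAt_zero_iff (r : LatticeRep G) (β μ : ℝ) :
    LightMultipletPressureAt r β 0 μ ↔
      ∃ C₀ : ℝ, 0 ≤ C₀ ∧ ∃ L : ℕ, ∀ S : ℕ, L ≤ S → ∀ m : ℕ, S + 1 ≤ 2 * (m + 2) →
        traceExcess r.ρ β (2 * S + 1) (m + 2) ≤
          C₀ * ((2 * S + 1 : ℕ) : ℝ) ^ 3 * Real.exp (-(μ * ((m + 2 : ℕ) : ℝ))) := by
  unfold LightMultipletPressureAt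
  constructor
  · rintro ⟨C₀, hC₀, L, h⟩
    refine ⟨C₀, hC₀, L, fun S hS m hm => ?_⟩
    obtain ⟨θ, -, hθ⟩ := h S hS
    simpa using hθ m hm
  · rintro ⟨C₀, hC₀, L, h⟩
    refine ⟨C₀, hC₀, L, fun S hS => ⟨Fin.elim0, fun k => Fin.elim0 k, fun m hm => ?_⟩⟩
    simpa using h S hS m hm

/-- Monotonicity in the rank: a larger light multiplet can only help (pad with `θ = 0`). -/
theorem LightMultipletPressureAt.mono {r : LatticeRep G} {β μ : ℝ} {Q Q' : ℕ} (hQ : Q ≤ Q')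
    (h : LightMultipletPressureAt r β Q μ) : LightMultipletPressureAt r β Q' μ := by
  obtain ⟨C₀, hC₀, L, hL⟩ := h
  refine ⟨C₀, hC₀, L, fun S hS => ?_⟩
  obtain ⟨θ, hθ, hm⟩ := hL S hS
  -- pad `θ : Fin Q → ℝ` by zeros: `Q' = Q + d`, `θ' = Fin.append θ 0`
  obtain ⟨d, rfl⟩ := Nat.exists_eq_add_of_le hQ
  refine ⟨Fin.append θ (fun _ : Fin d => (0 : ℝ)), fun k => ?_, fun m hmm => ?_⟩
  · induction k using Fin.addCases with
    | left i => simpa using hθ i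
    | right j => simp
  · have hsum : ∑ k, (Fin.append θ (fun _ : Fin d => (0 : ℝ)) k) ^ (m + 2) = ∑ k, θ k ^ (m + 2) := by
      rw [Fin.sum_univ_add]
      simp
    rw [hsum]
    exact hm m hmm

end LatticeW

end Summit.QuantumFields.YangMills.Cruxes.IR.FluxCodeBlindness

end
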